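import Summits.ResolutionOfSingularities.ResolutionOfSingularities.Theorems.WildQuotientsWildQuotientResolutionBlowupExitBasicOpenSections
import Literature.AlgebraicGeometry.Resolution.AffineBlowupAlgebra
import HarnessLib

/-!
# [OURS · L1 W4.5a] E7 N5a `AffineBlowupChartFrame` — the Rees charts of `Bl_I(Spec R)` as AFFINE OPENS with their ring of
# sections identified with the affine blow-up algebras `R[I/x_σ]`, compatibly with the structure maps; cover; transports

Crux `FrobeniusLadder.FInjectiveMacaulayfication` = stmt-ResolutionOfSingularities-15315 (chain w45a), hole 5e, lead-1's E7 «two-level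
format engine», INSTANCE LAYER N5a (res-L1-w45a-lead-1 ANSWER 2026-08-27T10:46:50Z «N5a `AffineBlowupChartFrame` → res-type-034:
data-independent; needed by every two-level instance, T₁₁/3 and T⁽⁴⁾/5 alike»). Helper `--supports stmt-ResolutionOfSingularities-15315
--as helper`, typed by res-type-034. OURS: replaces the role of NOTHING in H. Hironaka's manuscript and is NOT a statement of it; AI-written
kernel glue of the cell `res-hironaka`, weaker than expert review. No definition, no named fact.

THE POINT. N4 `TwoLevelTower.twoLevelTower_good` (p523174) takes the level-1 blow-up `X′` with a finite family of AFFINE OPENS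
`U σ : X′.affineOpens`, rings of sections `Γ(X′, U σ)` that are Noetherian Jacobson domains of characteristic `p`, and certificate
blocks on `Γ(X′, U σ)`. For `X′ = affineBlowup I`, `I = (x_σ)`, the natural charts are the Rees charts `D₊(x_σ t)`; this file puts them
in exactly that currency:
* §1 `isAffineOpen_basicOpen_reesT` — `D₊(at)` is an affine open of `Bl_I(Spec R)` (Mathlib `Proj.isAffineOpen_basicOpen`);
  **`exists_sectionsEquiv_blowupAlgebra`** — a ring isomorphism `e : Γ(Bl_I(Spec R), D₊(at)) ≃+* R[I/a]` (Mathlib `Proj.basicOpenIsoAway`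
  ∘ the tree's `reesChartEquiv`) COMMUTING WITH THE STRUCTURE MAPS: `e (π^*(r)|_{D₊(at)}) = r/1` (the tree's
  `BlowupExit.appLE_π_eq_awayToSection`, res-D-pv-033 AS res-L1-w45c-stub-5, + `reesChartEquiv_reesChartBase`) — so every certificate
  computed on `R[I/a]` (E6‴ `hon`, N2/N3) moves to `Γ(X′, U σ)` by `CertifiedCoverCongr` along `e.symm`, and ideals `𝔟 = (π^* r_i)` go to
  `(r_i/1)`;
* §2 `irrelevant_le_span_reesT_of_span_range` / `iSup_basicOpen_reesT_eq_top_of_span_range` — for `I = (x_σ)_σ` the charts `D₊(x_σ t)`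
  COVER the blow-up (`⨆ σ = ⊤`; Mathlib `Proj.iSup_basicOpen_eq_top`), hence the pointwise form `exists_mem_basicOpen_reesT` (N4's
  `hcover` at EVERY point, not only over `b`);
* §3 transports along `e` for N4's `hdom / hnoeth / hchar / hjac` binders: `isDomain_sections`, `isNoetherianRing_sections`, `charP_sections`,
  `isJacobsonRing_sections` — each from the corresponding property of `R[I/a]`.
The POINT DICTIONARY (primes of `Γ(_, U σ)` ↔ primes of `R[I/a]`, `π` on points) is NOT in this file: N4's `h𝔟` is discharged by
res-type-002's N4b/N4c (`FibreIdealOfBasePoint`/`FibreIdealOfOrigin`, p523736/p524704) from `π₁.base (fromSpec z) = b` directly, and §1's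
compatibility moves the resulting `𝔟 σ = (π^* x_i)` to `(x_i/1) ⊆ R[I/x_σ]`; a points lemma is added on request (rev 2).
References: Mathlib `AlgebraicGeometry.ProjectiveSpectrum.Basic` (`Proj.basicOpenIsoAway`, `Proj.isAffineOpen_basicOpen`,
`Proj.iSup_basicOpen_eq_top`); The Stacks Project, Tag 0804 — background.
-/

-- single-problem summit: the doubled namespace component is forced
set_option linter.dupNamespace false

noncomputable section

open AlgebraicGeometry CategoryTheory TopologicalSpace HomogeneousLocalization
open Literature.AlgebraicGeometry.Resolution

namespace Summit.ResolutionOfSingularities.ResolutionOfSingularities.Theorems.FInjectiveMacaulayfication.AffineBlowupChartFrame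

universe u

variable {R : Type u} [CommRing R] (I : Ideal R) (a : R) (ha : a ∈ I)

/-! ## §1 The Rees chart `D₊(at)` is affine and its sections are `R[I/a]`, compatibly with the structure maps -/

/-- **`D₊(at)` is an affine open of `Bl_I(Spec R)`** (`at` is homogeneous of degree `1 > 0`). [folklore; Mathlib
`Proj.isAffineOpen_basicOpen`] -/
theorem isAffineOpen_basicOpen_reesT : IsAffineOpen (Proj.basicOpen (reesGrading I) (reesT a ha)) :=
  Proj.isAffineOpen_basicOpen _ _ (reesT_mem a ha) Nat.one_pos

/-- `D₊(at) ≤ π⁻¹(⊤)` (the trivial inequality the `appLE` statements carry). [folklore] -/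
theorem basicOpen_reesT_le_preimage_top :
    Proj.basicOpen (reesGrading I) (reesT a ha) ≤ affineBlowup.π I ⁻¹ᵁ ⊤ :=
  le_top

/-- **THE SECTIONS OF THE CHART ARE THE AFFINE BLOW-UP ALGEBRA, compatibly with the structure maps.** There is a ring isomorphism
`e : Γ(Bl_I(Spec R), D₊(at)) ≃+* R[I/a]` with `e (π^*(r)|_{D₊(at)}) = r/1 = algebraMap R R[I/a] r` for every `r ∈ R`
(`e` = Mathlib's `(Proj.basicOpenIsoAway …)⁻¹ : Γ(Proj, D₊(at)) ≅ (R[It])_{(at)}` followed by the tree's `reesChartEquiv : (R[It])_{(at)}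
≃+* R[I/a]`; the compatibility is `BlowupExit.appLE_π_eq_awayToSection` + `reesChartEquiv_reesChartBase`). [folklore; OURS glue] -/
theorem exists_sectionsEquiv_blowupAlgebra :
    ∃ e : Γ(affineBlowup I, Proj.basicOpen (reesGrading I) (reesT a ha)) ≃+* blowupAlgebra I a,
      ∀ r : R, e ((affineBlowup.π I).appLE ⊤ (Proj.basicOpen (reesGrading I) (reesT a ha)) le_top
        ((Scheme.ΓSpecIso (CommRingCat.of R)).inv r)) = algebraMap R (blowupAlgebra I a) r := by
  let E := (Proj.basicOpenIsoAway (reesGrading I) (reesT a ha) (reesT_mem a ha) Nat.one_pos).commRingCatIsoToRingEquiv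
  refine ⟨E.symm.trans (reesChartEquiv a ha), fun r => ?_⟩
  rw [RingEquiv.trans_apply,
    WildQuotientResolution.BlowupExit.appLE_π_eq_awayToSection (reesT a ha) (reesT_mem a ha) Nat.one_pos le_top r]
  have h1 : E.symm (Proj.awayToSection (reesGrading I) (reesT a ha)
      (((fromZeroRingHom (reesGrading I) (.powers (reesT a ha))).comp (reesGrading.zeroRingHom I)) r)) =
      reesChartBase a ha r := by
    rw [RingEquiv.symm_apply_eq]
    rfl
  rw [h1, reesChartEquiv_reesChartBase]

/-! ## §2 The charts of the generators cover the blow-up -/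

/-- For `I = (x_σ)_σ`, the irrelevant ideal `R[It]₊` lies in the ideal generated by the `x_σ t` (every `bt`, `b = Σ c_σ x_σ ∈ I`, is
`Σ c_σ · (x_σ t)`). [folklore] -/
theorem irrelevant_le_span_reesT_of_span_range {N : ℕ} (x : Fin N → R) (hI : I = Ideal.span (Set.range x))
    (hx : ∀ σ, x σ ∈ I) :
    (HomogeneousIdeal.irrelevant (reesGrading I)).toIdeal ≤
      Ideal.span (Set.range fun σ : Fin N => reesT (I := I) (x σ) (hx σ)) := by
  classical
  refine le_trans (irrelevant_le_span_reesT I) ?_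
  rw [Ideal.span_le]
  rintro _ ⟨⟨b, hb⟩, rfl⟩
  have hb' : b ∈ Ideal.span (Set.range x) := hI ▸ hb
  obtain ⟨c, hc⟩ := Ideal.mem_span_range_iff_exists_fun.mp hb'
  have key : reesT (I := I) b hb = ∑ σ, algebraMap R (reesAlgebra I) (c σ) * reesT (I := I) (x σ) (hx σ) := by
    apply Subtype.ext
    rw [coe_reesT, AddSubmonoidClass.coe_finsetSum, ← hc, map_sum (Polynomial.monomial 1)]
    refine Finset.sum_congr rfl fun σ _ => ?_
    rw [Subalgebra.coe_mul, Subalgebra.coe_algebraMap, coe_reesT, Polynomial.algebraMap_apply, Algebra.algebraMap_self,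
      RingHom.id_apply, Polynomial.C_mul_monomial]
  show reesT (I := I) b hb ∈ _
  rw [key]
  exact Ideal.sum_mem _ fun σ _ => Ideal.mul_mem_left _ _ (Ideal.subset_span ⟨σ, rfl⟩)

/-- **The charts `D₊(x_σ t)` of the generators COVER `Bl_I(Spec R)`**, `I = (x_σ)_σ`. [folklore; Mathlib `Proj.iSup_basicOpen_eq_top`] -/
theorem iSup_basicOpen_reesT_eq_top_of_span_range {N : ℕ} (x : Fin N → R) (hI : I = Ideal.span (Set.range x))
    (hx : ∀ σ, x σ ∈ I) :
    ⨆ σ : Fin N, Proj.basicOpen (reesGrading I) (reesT (I := I) (x σ) (hx σ)) = ⊤ :=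
  Proj.iSup_basicOpen_eq_top (reesGrading I) (fun σ : Fin N => reesT (I := I) (x σ) (hx σ))
    (irrelevant_le_span_reesT_of_span_range I x hI hx)

/-- Pointwise form (N4's `hcover`, at EVERY point): each point of `Bl_I(Spec R)` lies in some chart `D₊(x_σ t)`. [folklore] -/
theorem exists_mem_basicOpen_reesT {N : ℕ} (x : Fin N → R) (hI : I = Ideal.span (Set.range x)) (hx : ∀ σ, x σ ∈ I)
    (y : ↥(affineBlowup I)) : ∃ σ : Fin N, y ∈ Proj.basicOpen (reesGrading I) (reesT (I := I) (x σ) (hx σ)) := by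
  have h := iSup_basicOpen_reesT_eq_top_of_span_range I x hI hx
  have hy : y ∈ (⨆ σ : Fin N, Proj.basicOpen (reesGrading I) (reesT (I := I) (x σ) (hx σ))) := by
    rw [h]; trivial
  exact Opens.mem_iSup.mp hy

/-! ## §3 Transports along the sections isomorphism (N4's `hdom / hnoeth / hchar / hjac` binders) -/

/-- `Γ(Bl, D₊(at))` is a domain when `R[I/a]` is. [folklore] -/
theorem isDomain_sections [IsDomain (blowupAlgebra I a)] :
    IsDomain Γ(affineBlowup I, Proj.basicOpen (reesGrading I) (reesT a ha)) := by
  obtain ⟨e, -⟩ := exists_sectionsEquiv_blowupAlgebra I a ha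
  exact MulEquiv.isDomain (blowupAlgebra I a) e.toMulEquiv

/-- `Γ(Bl, D₊(at))` is Noetherian when `R[I/a]` is. [folklore] -/
theorem isNoetherianRing_sections [IsNoetherianRing (blowupAlgebra I a)] :
    IsNoetherianRing Γ(affineBlowup I, Proj.basicOpen (reesGrading I) (reesT a ha)) := by
  obtain ⟨e, -⟩ := exists_sectionsEquiv_blowupAlgebra I a ha
  exact isNoetherianRing_of_ringEquiv _ e.symm

/-- `Γ(Bl, D₊(at))` has characteristic `p` when `R[I/a]` has. [folklore] -/
theorem charP_sections (p : ℕ) [CharP (blowupAlgebra I a) p] :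
    CharP Γ(affineBlowup I, Proj.basicOpen (reesGrading I) (reesT a ha)) p := by
  obtain ⟨e, -⟩ := exists_sectionsEquiv_blowupAlgebra I a ha
  exact charP_of_injective_ringHom (f := e.symm.toRingHom) e.symm.injective p

/-- `Γ(Bl, D₊(at))` is a Jacobson ring when `R[I/a]` is. [folklore] -/
theorem isJacobsonRing_sections [IsJacobsonRing (blowupAlgebra I a)] :
    IsJacobsonRing Γ(affineBlowup I, Proj.basicOpen (reesGrading I) (reesT a ha)) := by
  obtain ⟨e, -⟩ := exists_sectionsEquiv_blowupAlgebra I a ha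
  exact isJacobsonRing_of_surjective ⟨e.symm.toRingHom, e.symm.surjective⟩

end Summit.ResolutionOfSingularities.ResolutionOfSingularities.Theorems.FInjectiveMacaulayfication.AffineBlowupChartFrame

end
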